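import Mathlib
import HarnessLib
import Literature.NumberTheory.LFunctions.ZetaScrew
import Summits.RiemannHypothesis.RiemannHypothesis.Theorems.IntegerScrewIncrementBrackets

/-!
# Route `IntegerScrew` — the `K`-NODE TRIAL GAIN tends to `S_K` (PIVOT-LAW §15.3, analytic half;
# RH-FREE, no matrix, no pivot — `Ψ` on the wall only)

For the trial increment coefficients `t_0 = 1`, `t_k = −(c_k/2)/log M` (`1 ≤ k ≤ K`), `t_{K+1} = 0`, the
gain of the corresponding predictor over the one-node energy, scaled by `log M`, converges:
`(M·B_M(0,0) − M·Σ_{j,k≤K} t_j t_k B_M(j,k))·log M → S_K = Σ_{k=1}^{K}(c_k/2)²`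
(`tendsto_kNode_gainFunctional` for the peeled form, `eventually_kNode_trialGain_ge` for the `ε`-form used
by `IntegerScrewKNodeFloor`), from the three bracket limits of `IntegerScrewIncrementBrackets`.  Combined
with the trial inequality `IntegerScrewKNodeForm.screwPivot_le_incrementForm` (which needs `S_{M−1} ≻ 0`)
this is the `K`-node floor `G(M)·log M ≥ S_K − o(1)`; this file is the part that does not mention the
pivot.  `S_K ↑ V/2 = ¼Σ_{k≥1}(Δ²[k log k])² = 0.6493591`, the Szegő continuum constant (§15.4).  Nothing
here bears on the truth of RH. [Suzuki2023, (1.1)]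
-/

noncomputable section

-- D-0017: `Summit.<S>.<S>.…` is the designed namespace of a single-problem summit.
set_option linter.dupNamespace false

namespace Summit.RiemannHypothesis.RiemannHypothesis.Theorems.IntegerScrew

open Literature.NumberTheory.LFunctions Filter Finset
open scoped Topology

/-- The bookkeeping identity behind the trial vector `I_M − (1/log M)·Σ_{k≤K} (c_k/2)·I_{M−k}`
(`σ(1) = 1`, `σ(k+2) = −s_{k+1}/L`): with `W = Mr·β(0,0)`,
`(W − Mr·Σ_{j,k≤K} σ(j+1)σ(k+1)β(j,k))·L = Σ_{k<K} s_{k+1}·Mrβ(0,k+1) + Σ_{j<K}(s_{j+1}·Mrβ(j+1,0) − (Σ_{k<K} s_{j+1}s_{k+1}·Mrβ(j+1,k+1))/L)`.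
[folklore] -/
private theorem peel_identity (K : ℕ) (β : ℕ → ℕ → ℝ) (σ s : ℕ → ℝ) (Mr L : ℝ) (hL : L ≠ 0)
    (hσ1 : σ 1 = 1) (hσ : ∀ k, k < K → σ (k + 1 + 1) = -s (k + 1) / L) :
    (Mr * β 0 0 - Mr * ∑ j ∈ range (K + 1), ∑ k ∈ range (K + 1), σ (j + 1) * σ (k + 1) * β j k) * L
      = ∑ k ∈ range K, s (k + 1) * (Mr * β 0 (k + 1))
        + ∑ j ∈ range K, (s (j + 1) * (Mr * β (j + 1) 0)
          - (∑ k ∈ range K, s (j + 1) * s (k + 1) * (Mr * β (j + 1) (k + 1))) / L) := by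
  simp only [Finset.sum_range_succ', zero_add, hσ1, one_mul, mul_one]
  have hin : ∀ j ∈ range K,
      (∑ k ∈ range K, σ (j + 1 + 1) * σ (k + 1 + 1) * β (j + 1) (k + 1)) + σ (j + 1 + 1) * β (j + 1) 0
      = (∑ k ∈ range K, (s (j + 1) * s (k + 1) / L ^ 2) * β (j + 1) (k + 1))
        + (-(s (j + 1)) / L) * β (j + 1) 0 := by
    intro j hj
    rw [hσ j (mem_range.1 hj)]
    congr 1
    refine Finset.sum_congr rfl fun k hk => ?_
    rw [hσ k (mem_range.1 hk)]
    ring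
  rw [Finset.sum_congr rfl hin]
  have hin0 : ∑ k ∈ range K, σ (k + 1 + 1) * β 0 (k + 1)
      = ∑ k ∈ range K, (-(s (k + 1)) / L) * β 0 (k + 1) :=
    Finset.sum_congr rfl fun k hk => by rw [hσ k (mem_range.1 hk)]
  rw [hin0]
  have e1 : ∀ j : ℕ, -(Mr * L) * ((∑ k ∈ range K, (s (j + 1) * s (k + 1) / L ^ 2) * β (j + 1) (k + 1))
        + (-(s (j + 1)) / L) * β (j + 1) 0)
      = s (j + 1) * (Mr * β (j + 1) 0)
          - (∑ k ∈ range K, s (j + 1) * s (k + 1) * (Mr * β (j + 1) (k + 1))) / L := by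
    intro j
    rw [Finset.sum_div, mul_add, Finset.mul_sum]
    have : ∀ k ∈ range K, -(Mr * L) * ((s (j + 1) * s (k + 1) / L ^ 2) * β (j + 1) (k + 1))
        = -(s (j + 1) * s (k + 1) * (Mr * β (j + 1) (k + 1)) / L) := by
      intro k _; field_simp
    rw [Finset.sum_congr rfl this, Finset.sum_neg_distrib]
    have e : -(Mr * L) * ((-(s (j + 1)) / L) * β (j + 1) 0) = s (j + 1) * (Mr * β (j + 1) 0) := by
      field_simp
    rw [e]
    ring
  have e0 : ∀ k : ℕ, -(Mr * L) * ((-(s (k + 1)) / L) * β 0 (k + 1)) = s (k + 1) * (Mr * β 0 (k + 1)) := by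
    intro k; field_simp
  calc (Mr * β 0 0 - Mr * (∑ j ∈ range K,
          ((∑ k ∈ range K, (s (j + 1) * s (k + 1) / L ^ 2) * β (j + 1) (k + 1))
            + (-(s (j + 1)) / L) * β (j + 1) 0)
          + (∑ k ∈ range K, (-(s (k + 1)) / L) * β 0 (k + 1) + β 0 0))) * L
      = ∑ k ∈ range K, -(Mr * L) * ((-(s (k + 1)) / L) * β 0 (k + 1))
        + ∑ j ∈ range K, -(Mr * L) * ((∑ k ∈ range K, (s (j + 1) * s (k + 1) / L ^ 2) * β (j + 1) (k + 1))
            + (-(s (j + 1)) / L) * β (j + 1) 0) := by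
        rw [← Finset.mul_sum, ← Finset.mul_sum]; ring
    _ = _ := by
        rw [Finset.sum_congr rfl fun k _ => e0 k, Finset.sum_congr rfl fun j _ => e1 j]

/-- **THE PEELED GAIN FUNCTIONAL CONVERGES TO `S_K`:**
`Σ_{k<K} s_{k+1}·(M·B_M(0,k+1)) + Σ_{j<K}(s_{j+1}·(M·B_M(j+1,0)) − (Σ_{k<K} s_{j+1}s_{k+1}·(M·B_M(j+1,k+1)))/log M)
 → Σ_{k=1}^{K} s_k²`, `s_k = c_k/2`. [folklore] -/
theorem tendsto_kNode_gainFunctional (K : ℕ) :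
    Tendsto (fun M : ℕ =>
      ∑ k ∈ range K, (-((((k + 1 : ℕ) : ℝ) + 1) * Real.log (((k + 1 : ℕ) : ℝ) + 1) - 2 * ((((k + 1 : ℕ) : ℝ)) * Real.log ((k + 1 : ℕ) : ℝ))
            + ((((k + 1 : ℕ) : ℝ)) - 1) * Real.log ((((k + 1 : ℕ) : ℝ)) - 1)) / 2) * ((M : ℝ) * (zetaScrew (Real.log ((M : ℝ) - ((0 : ℕ) : ℝ)) - Real.log ((M : ℝ) - (((k + 1 : ℕ) : ℝ) + 1)))
        + zetaScrew (Real.log ((M : ℝ) - (((0 : ℕ) : ℝ) + 1)) - Real.log ((M : ℝ) - ((k + 1 : ℕ) : ℝ)))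
        - zetaScrew (Real.log ((M : ℝ) - ((0 : ℕ) : ℝ)) - Real.log ((M : ℝ) - ((k + 1 : ℕ) : ℝ)))
        - zetaScrew (Real.log ((M : ℝ) - (((0 : ℕ) : ℝ) + 1)) - Real.log ((M : ℝ) - (((k + 1 : ℕ) : ℝ) + 1)))))
        + ∑ j ∈ range K, ((-((((j + 1 : ℕ) : ℝ) + 1) * Real.log (((j + 1 : ℕ) : ℝ) + 1) - 2 * ((((j + 1 : ℕ) : ℝ)) * Real.log ((j + 1 : ℕ) : ℝ))
            + ((((j + 1 : ℕ) : ℝ)) - 1) * Real.log ((((j + 1 : ℕ) : ℝ)) - 1)) / 2) * ((M : ℝ) * (zetaScrew (Real.log ((M : ℝ) - ((j + 1 : ℕ) : ℝ)) - Real.log ((M : ℝ) - (((0 : ℕ) : ℝ) + 1)))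
        + zetaScrew (Real.log ((M : ℝ) - (((j + 1 : ℕ) : ℝ) + 1)) - Real.log ((M : ℝ) - ((0 : ℕ) : ℝ)))
        - zetaScrew (Real.log ((M : ℝ) - ((j + 1 : ℕ) : ℝ)) - Real.log ((M : ℝ) - ((0 : ℕ) : ℝ)))
        - zetaScrew (Real.log ((M : ℝ) - (((j + 1 : ℕ) : ℝ) + 1)) - Real.log ((M : ℝ) - (((0 : ℕ) : ℝ) + 1)))))
          - (∑ k ∈ range K, (-((((j + 1 : ℕ) : ℝ) + 1) * Real.log (((j + 1 : ℕ) : ℝ) + 1) - 2 * ((((j + 1 : ℕ) : ℝ)) * Real.log ((j + 1 : ℕ) : ℝ))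
            + ((((j + 1 : ℕ) : ℝ)) - 1) * Real.log ((((j + 1 : ℕ) : ℝ)) - 1)) / 2) * (-((((k + 1 : ℕ) : ℝ) + 1) * Real.log (((k + 1 : ℕ) : ℝ) + 1) - 2 * ((((k + 1 : ℕ) : ℝ)) * Real.log ((k + 1 : ℕ) : ℝ))
            + ((((k + 1 : ℕ) : ℝ)) - 1) * Real.log ((((k + 1 : ℕ) : ℝ)) - 1)) / 2) * ((M : ℝ) * (zetaScrew (Real.log ((M : ℝ) - ((j + 1 : ℕ) : ℝ)) - Real.log ((M : ℝ) - (((k + 1 : ℕ) : ℝ) + 1)))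
        + zetaScrew (Real.log ((M : ℝ) - (((j + 1 : ℕ) : ℝ) + 1)) - Real.log ((M : ℝ) - ((k + 1 : ℕ) : ℝ)))
        - zetaScrew (Real.log ((M : ℝ) - ((j + 1 : ℕ) : ℝ)) - Real.log ((M : ℝ) - ((k + 1 : ℕ) : ℝ)))
        - zetaScrew (Real.log ((M : ℝ) - (((j + 1 : ℕ) : ℝ) + 1)) - Real.log ((M : ℝ) - (((k + 1 : ℕ) : ℝ) + 1)))))) / Real.log (M : ℝ))) atTop
      (𝓝 (∑ k ∈ Finset.Icc 1 K, (-((((k : ℕ) : ℝ) + 1) * Real.log (((k : ℕ) : ℝ) + 1) - 2 * ((((k : ℕ) : ℝ)) * Real.log ((k : ℕ) : ℝ))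
            + ((((k : ℕ) : ℝ)) - 1) * Real.log ((((k : ℕ) : ℝ)) - 1)) / 2) ^ 2)) := by
  set s : ℕ → ℝ := fun k => (-((((k : ℕ) : ℝ) + 1) * Real.log (((k : ℕ) : ℝ) + 1) - 2 * ((((k : ℕ) : ℝ)) * Real.log ((k : ℕ) : ℝ))
            + ((((k : ℕ) : ℝ)) - 1) * Real.log ((((k : ℕ) : ℝ)) - 1)) / 2) with hs
  set β : ℕ → ℕ → ℕ → ℝ := fun M j k => (zetaScrew (Real.log ((M : ℝ) - (j : ℝ)) - Real.log ((M : ℝ) - ((k : ℝ) + 1)))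
        + zetaScrew (Real.log ((M : ℝ) - ((j : ℝ) + 1)) - Real.log ((M : ℝ) - (k : ℝ)))
        - zetaScrew (Real.log ((M : ℝ) - (j : ℝ)) - Real.log ((M : ℝ) - (k : ℝ)))
        - zetaScrew (Real.log ((M : ℝ) - ((j : ℝ) + 1)) - Real.log ((M : ℝ) - ((k : ℝ) + 1)))) with hβ
  have hrow : ∀ k : ℕ, Tendsto (fun M : ℕ => (M : ℝ) * β M 0 (k + 1)) atTop (𝓝 (s (k + 1))) := by
    intro k
    have h := tendsto_mul_incrementBracket (j := 0) (k := k + 1) (by omega)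
    simp only [hβ, hs] at h ⊢
    exact h
  have hcol : ∀ k : ℕ, Tendsto (fun M : ℕ => (M : ℝ) * β M (k + 1) 0) atTop (𝓝 (s (k + 1))) := by
    intro k
    refine (hrow k).congr fun M => ?_
    simp only [hβ]
    rw [incrementBracket_comm (M : ℝ) ((0 : ℕ) : ℝ) (((k + 1 : ℕ) : ℝ))]
  have hblock : ∀ j k : ℕ, Tendsto (fun M : ℕ => (M : ℝ) * β M (j + 1) (k + 1) / Real.log (M : ℝ))
      atTop (𝓝 (if j = k then 1 else 0)) := by
    intro j k
    by_cases hjk : j = k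
    · subst hjk
      simp only [if_true, hβ]
      exact tendsto_mul_incrementBracket_diag_div_log (j + 1)
    · simp only [hjk, if_false, hβ]
      exact tendsto_mul_incrementBracket_div_log (j := j + 1) (k := k + 1) (by omega)
  have hR : Tendsto (fun M : ℕ =>
      ∑ k ∈ range K, s (k + 1) * ((M : ℝ) * β M 0 (k + 1))
        + ∑ j ∈ range K, (s (j + 1) * ((M : ℝ) * β M (j + 1) 0)
          - (∑ k ∈ range K, s (j + 1) * s (k + 1) * ((M : ℝ) * β M (j + 1) (k + 1)))
            / Real.log (M : ℝ))) atTop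
      (𝓝 (∑ k ∈ range K, s (k + 1) * s (k + 1)
        + ∑ j ∈ range K, (s (j + 1) * s (j + 1)
          - ∑ k ∈ range K, s (j + 1) * s (k + 1) * (if j = k then 1 else 0)))) := by
    refine (tendsto_finsetSum _ fun k _ => (hrow k).const_mul _).add
      (tendsto_finsetSum _ fun j _ => ((hcol j).const_mul _).sub ?_)
    have : Tendsto (fun M : ℕ => ∑ k ∈ range K,
        s (j + 1) * s (k + 1) * ((M : ℝ) * β M (j + 1) (k + 1) / Real.log (M : ℝ))) atTop
        (𝓝 (∑ k ∈ range K, s (j + 1) * s (k + 1) * (if j = k then 1 else 0))) :=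
      tendsto_finsetSum _ fun k _ => (hblock j k).const_mul _
    refine this.congr fun M => ?_
    rw [Finset.sum_div]
    exact Finset.sum_congr rfl fun k _ => by ring
  have hval : ∑ k ∈ range K, s (k + 1) * s (k + 1)
        + ∑ j ∈ range K, (s (j + 1) * s (j + 1)
          - ∑ k ∈ range K, s (j + 1) * s (k + 1) * (if j = k then 1 else 0))
      = ∑ k ∈ Finset.Icc 1 K, s k ^ 2 := by
    have hdiag : ∀ j ∈ range K,
        ∑ k ∈ range K, s (j + 1) * s (k + 1) * (if j = k then (1 : ℝ) else 0) = s (j + 1) * s (j + 1) := by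
      intro j hj
      simp_rw [mul_ite, mul_one, mul_zero]
      rw [Finset.sum_ite_eq]
      simp [hj]
    rw [Finset.sum_congr rfl fun j hj =>
      (show s (j + 1) * s (j + 1) - ∑ k ∈ range K, s (j + 1) * s (k + 1) * (if j = k then (1 : ℝ) else 0)
          = 0 by rw [hdiag j hj, sub_self])]
    simp only [Finset.sum_const_zero, add_zero]
    rw [show Finset.Icc 1 K = Finset.Ico 1 (K + 1) from rfl, Finset.sum_Ico_eq_sum_range,
      Nat.add_sub_cancel]
    exact Finset.sum_congr rfl fun k _ => by rw [add_comm 1 k]; ring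
  rw [hval] at hR
  simp only [hs, hβ] at hR
  exact hR

/-- **THE TRIAL GAIN IN `σ`-FORM, eventually `≥ S_K − ε`:** with
`σ_M(a) = 0, 1, −s_{a−1}/log M, 0` for `a = 0`, `a = 1`, `2 ≤ a ≤ K+1`, `a ≥ K+2` respectively,
`S_K − ε ≤ (M·B_M(0,0) − M·Σ_{j,k≤K} σ_M(j+1)σ_M(k+1)B_M(j,k))·log M` for all large `M`. [folklore] -/
theorem eventually_kNode_trialGain_ge (K : ℕ) (ε : ℝ) (hε : 0 < ε) :
    ∀ᶠ M : ℕ in atTop,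
      (∑ k ∈ Finset.Icc 1 K, (-((((k : ℕ) : ℝ) + 1) * Real.log (((k : ℕ) : ℝ) + 1) - 2 * ((((k : ℕ) : ℝ)) * Real.log ((k : ℕ) : ℝ))
            + ((((k : ℕ) : ℝ)) - 1) * Real.log ((((k : ℕ) : ℝ)) - 1)) / 2) ^ 2) - ε ≤
        ((M : ℝ) * (zetaScrew (Real.log ((M : ℝ) - ((0 : ℕ) : ℝ)) - Real.log ((M : ℝ) - (((0 : ℕ) : ℝ) + 1)))
        + zetaScrew (Real.log ((M : ℝ) - (((0 : ℕ) : ℝ) + 1)) - Real.log ((M : ℝ) - ((0 : ℕ) : ℝ)))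
        - zetaScrew (Real.log ((M : ℝ) - ((0 : ℕ) : ℝ)) - Real.log ((M : ℝ) - ((0 : ℕ) : ℝ)))
        - zetaScrew (Real.log ((M : ℝ) - (((0 : ℕ) : ℝ) + 1)) - Real.log ((M : ℝ) - (((0 : ℕ) : ℝ) + 1))))
          - (M : ℝ) * ∑ j ∈ range (K + 1), ∑ k ∈ range (K + 1),
              (fun a : ℕ => if a = 0 then (0 : ℝ) else if a = 1 then 1 else if a ≤ K + 1 then
          -(-((((a - 1 : ℕ) : ℝ) + 1) * Real.log (((a - 1 : ℕ) : ℝ) + 1) - 2 * ((((a - 1 : ℕ) : ℝ)) * Real.log ((a - 1 : ℕ) : ℝ))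
            + ((((a - 1 : ℕ) : ℝ)) - 1) * Real.log ((((a - 1 : ℕ) : ℝ)) - 1)) / 2) / Real.log (M : ℝ) else 0) (j + 1) * (fun a : ℕ => if a = 0 then (0 : ℝ) else if a = 1 then 1 else if a ≤ K + 1 then
          -(-((((a - 1 : ℕ) : ℝ) + 1) * Real.log (((a - 1 : ℕ) : ℝ) + 1) - 2 * ((((a - 1 : ℕ) : ℝ)) * Real.log ((a - 1 : ℕ) : ℝ))
            + ((((a - 1 : ℕ) : ℝ)) - 1) * Real.log ((((a - 1 : ℕ) : ℝ)) - 1)) / 2) / Real.log (M : ℝ) else 0) (k + 1) * (zetaScrew (Real.log ((M : ℝ) - (j : ℝ)) - Real.log ((M : ℝ) - ((k : ℝ) + 1)))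
        + zetaScrew (Real.log ((M : ℝ) - ((j : ℝ) + 1)) - Real.log ((M : ℝ) - (k : ℝ)))
        - zetaScrew (Real.log ((M : ℝ) - (j : ℝ)) - Real.log ((M : ℝ) - (k : ℝ)))
        - zetaScrew (Real.log ((M : ℝ) - ((j : ℝ) + 1)) - Real.log ((M : ℝ) - ((k : ℝ) + 1))))) * Real.log (M : ℝ) := by
  set s : ℕ → ℝ := fun k => (-((((k : ℕ) : ℝ) + 1) * Real.log (((k : ℕ) : ℝ) + 1) - 2 * ((((k : ℕ) : ℝ)) * Real.log ((k : ℕ) : ℝ))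
            + ((((k : ℕ) : ℝ)) - 1) * Real.log ((((k : ℕ) : ℝ)) - 1)) / 2) with hs
  set β : ℕ → ℕ → ℕ → ℝ := fun M j k => (zetaScrew (Real.log ((M : ℝ) - (j : ℝ)) - Real.log ((M : ℝ) - ((k : ℝ) + 1)))
        + zetaScrew (Real.log ((M : ℝ) - ((j : ℝ) + 1)) - Real.log ((M : ℝ) - (k : ℝ)))
        - zetaScrew (Real.log ((M : ℝ) - (j : ℝ)) - Real.log ((M : ℝ) - (k : ℝ)))
        - zetaScrew (Real.log ((M : ℝ) - ((j : ℝ) + 1)) - Real.log ((M : ℝ) - ((k : ℝ) + 1)))) with hβ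
  have hR := tendsto_kNode_gainFunctional K
  have hRev := hR.eventually (lt_mem_nhds (sub_lt_self _ hε))
  filter_upwards [hRev, eventually_gt_atTop 1] with M hRM hM1
  set L : ℝ := Real.log (M : ℝ) with hL
  have hL0 : 0 < L := Real.log_pos (by exact_mod_cast hM1)
  set σ : ℕ → ℝ := (fun a : ℕ => if a = 0 then (0 : ℝ) else if a = 1 then 1 else if a ≤ K + 1 then
          -(-((((a - 1 : ℕ) : ℝ) + 1) * Real.log (((a - 1 : ℕ) : ℝ) + 1) - 2 * ((((a - 1 : ℕ) : ℝ)) * Real.log ((a - 1 : ℕ) : ℝ))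
            + ((((a - 1 : ℕ) : ℝ)) - 1) * Real.log ((((a - 1 : ℕ) : ℝ)) - 1)) / 2) / Real.log (M : ℝ) else 0) with hσdef
  have hσ1 : σ 1 = 1 := by simp [hσdef]
  have hσ2 : ∀ k, k < K → σ (k + 1 + 1) = -s (k + 1) / L := by
    intro k hk
    simp only [hσdef, hs, show k + 1 + 1 ≠ 0 by omega, show k + 1 + 1 ≠ 1 by omega,
      show k + 1 + 1 ≤ K + 1 by omega, if_false, if_true, Nat.add_sub_cancel, hL]
  have hkey := peel_identity K (β M) σ s (M : ℝ) L hL0.ne' hσ1 hσ2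
  have hlhs : ((M : ℝ) * β M 0 0 - (M : ℝ) * ∑ j ∈ range (K + 1), ∑ k ∈ range (K + 1),
      σ (j + 1) * σ (k + 1) * β M j k) * L
      = ((M : ℝ) * (zetaScrew (Real.log ((M : ℝ) - ((0 : ℕ) : ℝ)) - Real.log ((M : ℝ) - (((0 : ℕ) : ℝ) + 1)))
        + zetaScrew (Real.log ((M : ℝ) - (((0 : ℕ) : ℝ) + 1)) - Real.log ((M : ℝ) - ((0 : ℕ) : ℝ)))
        - zetaScrew (Real.log ((M : ℝ) - ((0 : ℕ) : ℝ)) - Real.log ((M : ℝ) - ((0 : ℕ) : ℝ)))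
        - zetaScrew (Real.log ((M : ℝ) - (((0 : ℕ) : ℝ) + 1)) - Real.log ((M : ℝ) - (((0 : ℕ) : ℝ) + 1))))
          - (M : ℝ) * ∑ j ∈ range (K + 1), ∑ k ∈ range (K + 1),
              (fun a : ℕ => if a = 0 then (0 : ℝ) else if a = 1 then 1 else if a ≤ K + 1 then
          -(-((((a - 1 : ℕ) : ℝ) + 1) * Real.log (((a - 1 : ℕ) : ℝ) + 1) - 2 * ((((a - 1 : ℕ) : ℝ)) * Real.log ((a - 1 : ℕ) : ℝ))
            + ((((a - 1 : ℕ) : ℝ)) - 1) * Real.log ((((a - 1 : ℕ) : ℝ)) - 1)) / 2) / Real.log (M : ℝ) else 0) (j + 1) * (fun a : ℕ => if a = 0 then (0 : ℝ) else if a = 1 then 1 else if a ≤ K + 1 then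
          -(-((((a - 1 : ℕ) : ℝ) + 1) * Real.log (((a - 1 : ℕ) : ℝ) + 1) - 2 * ((((a - 1 : ℕ) : ℝ)) * Real.log ((a - 1 : ℕ) : ℝ))
            + ((((a - 1 : ℕ) : ℝ)) - 1) * Real.log ((((a - 1 : ℕ) : ℝ)) - 1)) / 2) / Real.log (M : ℝ) else 0) (k + 1) * (zetaScrew (Real.log ((M : ℝ) - (j : ℝ)) - Real.log ((M : ℝ) - ((k : ℝ) + 1)))
        + zetaScrew (Real.log ((M : ℝ) - ((j : ℝ) + 1)) - Real.log ((M : ℝ) - (k : ℝ)))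
        - zetaScrew (Real.log ((M : ℝ) - (j : ℝ)) - Real.log ((M : ℝ) - (k : ℝ)))
        - zetaScrew (Real.log ((M : ℝ) - ((j : ℝ) + 1)) - Real.log ((M : ℝ) - ((k : ℝ) + 1))))) * Real.log (M : ℝ) := by
    simp only [hβ, hσdef, hL]
  rw [← hlhs, hkey]
  simp only [hs, hβ]
  exact hRM.le

end Summit.RiemannHypothesis.RiemannHypothesis.Theorems.IntegerScrew
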